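import Literature.Computability.FineGrained.CliqueETHPositionGraph
import HarnessLib

/-!
# SETH-hardness of `k`-Dominating Set: the Pătraşcu–Williams graph of a CNF

The graph of the reduction of Pătraşcu–Williams (*On the possibility of faster SAT algorithms*,
SODA 2010, §2, Lemma 2.1 and Thm. 2.1): a CNF `φ` on `n` variables with `m` clauses and a number
`K ≥ 1` of groups are mapped to a graph on `N = K · 2^B + m + K` vertices (`B = ⌈n / K⌉`) that has
a dominating set of at most `K` vertices iff `φ` is satisfiable. The word-RAM program realising
the reduction (`…DomSetSETHReductionProgram`) numbers the vertices arithmetically; this file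
defines that numbering and proves it correct, in the Boolean form the program computes:

* vertices `a < K S` (`S = 2^B`) are the *partial assignments*: group `i = a / S`, mask
  `μ = a % S`; variable `v` belongs to group `v / B` and the mask of that group gives it the bit
  `μ.testBit (v % B)`; vertices `K S + j` (`j < m`) are the *clauses*; vertices `K S + m + i`
  (`i < K`) are the *dummies*;
* `satB φ B i μ j`: the partial assignment `(i, μ)` satisfies clause `j` (some literal of the clause
  lies in group `i` and gets its polarity); the adjacency `pwAdj` (row `a < K S` only; the graph is
  the symmetrisation `adjMatrixGraph`): same group / satisfied clause / own dummy;
* `pwN`, `pwMatrix`, `pwInstance φ K : (kDominatingSet K).Inst` and the correctness theorem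
  **`hasDominatingSetOfCard_pwMatrix_iff`**: for `K ≥ 1` the graph has a dominating set of at most
  `K` vertices iff `φ` is satisfiable (so `(kDominatingSet K).Good (pwInstance φ K)` is `{[1]}` or
  `{[0]}` accordingly, `kDominatingSet_good_pwInstance`);
* the word-level layout of the encoding `encodeBoolMatrix (pwMatrix φ K) = N :: ⟨bits, row-major⟩`
  (`kDominatingSet_encode_pwInstance_getElem?_entry`, `inputWidth_kDominatingSet_encode_pwInstance`:
  the input width is `Nat.size (N² + 1)`).

## References

* M. Pătraşcu, R. Williams, *On the possibility of faster SAT algorithms*, Proc. SODA 2010,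
  1065–1075, §2 (Hypothesis 1, Thm. 2.1, Lemma 2.1, p. 1068).
* V. Vassilevska Williams, *On some fine-grained questions in algorithms and complexity*,
  Proc. ICM 2018, §2 (input conventions of the word RAM).
-/

namespace Literature.Computability.FineGrained

open Cryptography Cryptography.WordRAM Complexity

/-! ### Partial assignments, satisfied clauses, the adjacency -/

section PWGraph

variable (φ : CNF ℕ) (B : ℕ)

/-- The partial assignment of group `i` with mask `μ` *satisfies* clause `j` of `φ`: some literal
`(v, p)` of the clause has its variable in group `i` (`v / B = i`, blocks of `B` consecutive
variables) and the mask gives it its polarity (`μ.testBit (v % B) = p`). (Pătraşcu–Williams 2010,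
proof of Lemma 2.1: "place an edge from a partial assignment node to a clause node iff the partial
assignment satisfies the clause".) [cite: PatrascuWilliams2010, Lemma 2.1] -/
def satB (i μ j : ℕ) : Bool :=
  match φ[j]? with
  | none => false
  | some cl => cl.any fun l => (l.1 / B == i) && (μ.testBit (l.1 % B) == l.2)

/-- The adjacency function of the **Pătraşcu–Williams graph** on vertex numbers, `K` groups of
`S` masks each and `m` clauses: row `a < K S` (group `a / S`, mask `a % S`) is joined to the
vertices of its own group (`c < K S`, `c / S = a / S`), to the clauses it satisfies
(`c = K S + j`), and to its own dummy (`c = K S + m + a / S`); rows `a ≥ K S` are empty (the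
graph is the symmetrisation, `adjMatrixGraph`). [cite: PatrascuWilliams2010, Lemma 2.1] -/
def pwAdj (K S m a c : ℕ) : Bool :=
  if a < K * S then
    if c < K * S then a / S == c / S
    else if c < K * S + m then satB φ B (a / S) (a % S) (c - K * S)
    else if c < K * S + m + K then a / S == c - (K * S + m)
    else false
  else false

variable {φ B}

/-- Unfolding `satB` on an existing clause. [folklore] -/
theorem satB_eq_true_iff {i μ j : ℕ} (hj : j < φ.length) : satB φ B i μ j = true ↔
    ∃ l ∈ φ[j], l.1 / B = i ∧ μ.testBit (l.1 % B) = l.2 := by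
  unfold satB
  rw [List.getElem?_eq_getElem hj]
  simp [List.any_eq_true]

/-- `satB` past the last clause. [folklore] -/
theorem satB_of_le {i μ j : ℕ} (hj : φ.length ≤ j) : satB φ B i μ j = false := by
  unfold satB; rw [List.getElem?_eq_none hj]

/-- Rows `a ≥ K S` of `pwAdj` are empty. [folklore] -/
theorem pwAdj_of_le {K S m a : ℕ} (ha : K * S ≤ a) (c : ℕ) : pwAdj φ B K S m a c = false := by
  unfold pwAdj; rw [if_neg (Nat.not_lt.2 ha)]

/-- Group columns of `pwAdj`. [folklore] -/
theorem pwAdj_group {K S m a c : ℕ} (ha : a < K * S) (hc : c < K * S) :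
    pwAdj φ B K S m a c = (a / S == c / S) := by
  unfold pwAdj; rw [if_pos ha, if_pos hc]

/-- Clause columns of `pwAdj`. [folklore] -/
theorem pwAdj_clause {K S m a j : ℕ} (ha : a < K * S) (hj : j < m) :
    pwAdj φ B K S m a (K * S + j) = satB φ B (a / S) (a % S) j := by
  unfold pwAdj; rw [if_pos ha, if_neg (by omega), if_pos (by omega), Nat.add_sub_cancel_left]

/-- Dummy columns of `pwAdj`. [folklore] -/
theorem pwAdj_dummy {K S m a i : ℕ} (ha : a < K * S) (hi : i < K) :
    pwAdj φ B K S m a (K * S + m + i) = (a / S == i) := by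
  unfold pwAdj
  rw [if_pos ha, if_neg (by omega), if_neg (by omega), if_pos (by omega), Nat.add_sub_cancel_left]

/-- Columns past the last vertex of `pwAdj`. [folklore] -/
theorem pwAdj_of_col_le {K S m a c : ℕ} (hc : K * S + m + K ≤ c) : pwAdj φ B K S m a c = false := by
  unfold pwAdj
  split_ifs <;> first | rfl | omega

end PWGraph

/-! ### The instance of `kDominatingSet K` -/

/-- The number of vertices `N = K · 2^B + m + K` of the Pătraşcu–Williams graph (`B = ⌈n / K⌉`,
`blockLen`). [cite: PatrascuWilliams2010, Lemma 2.1 ("the total number of nodes is k2^{n/k} + m + k")] -/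
def pwN (φ : CNF ℕ) (K : ℕ) : ℕ :=
  K * 2 ^ blockLen φ.numVars K + φ.length + K

/-- The adjacency matrix of the Pătraşcu–Williams graph (`pwAdj` on `Fin N`). [cite: PatrascuWilliams2010, Lemma 2.1] -/
def pwMatrix (φ : CNF ℕ) (K : ℕ) : Matrix (Fin (pwN φ K)) (Fin (pwN φ K)) Bool :=
  fun a c => pwAdj φ (blockLen φ.numVars K) K (2 ^ blockLen φ.numVars K) φ.length a c

/-- **The Pătraşcu–Williams instance** of `kDominatingSet K`: `N` vertices, adjacency `pwMatrix`.
[cite: PatrascuWilliams2010, Lemma 2.1] -/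
def pwInstance (φ : CNF ℕ) (K : ℕ) : (kDominatingSet K).Inst :=
  ⟨pwN φ K, pwMatrix φ K⟩

/-- The adjacency of the graph of the instance: the symmetrised, loop-free `pwAdj`. [folklore] -/
theorem adjMatrixGraph_pwMatrix_adj (φ : CNF ℕ) (K : ℕ) (a c : Fin (pwN φ K)) :
    (adjMatrixGraph (pwMatrix φ K)).Adj a c ↔ a ≠ c ∧
      (pwAdj φ (blockLen φ.numVars K) K (2 ^ blockLen φ.numVars K) φ.length a c = true ∨
        pwAdj φ (blockLen φ.numVars K) K (2 ^ blockLen φ.numVars K) φ.length c a = true) := by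
  simp only [adjMatrixGraph, SimpleGraph.fromRel_adj, pwMatrix]

/-- Every variable of a CNF on `n` variables lies in one of the `K` groups of `B = ⌈n/K⌉`
variables (`0 < K`). [folklore] -/
theorem div_blockLen_lt_of_lt_numVars {φ : CNF ℕ} {K v : ℕ} (hK : 0 < K) (hv : v < φ.numVars) :
    v / blockLen φ.numVars K < K :=
  Nat.div_lt_of_lt_mul (lt_of_lt_of_le hv (le_blockLen_mul hK))

/-! ### Correctness -/

section Correctness

variable {φ : CNF ℕ} {K : ℕ}

/-- **Correctness of the Pătraşcu–Williams graph** (SODA 2010, proof of Lemma 2.1). For `K ≥ 1`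
the graph has a dominating set of at most `K` vertices iff `φ` is satisfiable: the `K` dummies
have pairwise disjoint closed neighbourhoods (dummy `i` ∪ group `i`), so a dominating set of size
`≤ K` consists of exactly one vertex per group-or-its-dummy and no clause vertex, whence every
clause is satisfied by one of the chosen partial assignments, which glue to a satisfying
assignment; conversely the `K` restrictions of a satisfying assignment dominate everything.
[cite: PatrascuWilliams2010, Lemma 2.1] -/
theorem hasDominatingSetOfCard_pwMatrix_iff (hK : 1 ≤ K) :
    HasDominatingSetOfCard (adjMatrixGraph (pwMatrix φ K)) K ↔ φ.Satisfiable := by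
  classical
  -- notation
  set n := φ.numVars with hn
  set m := φ.length with hm
  set B := blockLen n K with hB
  set S := 2 ^ B with hS
  have hSpos : 0 < S := Nat.pow_pos (by norm_num)
  have hN : pwN φ K = K * S + m + K := rfl
  have hadj := adjMatrixGraph_pwMatrix_adj φ K
  constructor
  · -- from a dominating set to a satisfying assignment
    rintro ⟨D, hcard, hdom⟩
    -- the dummies and their witnesses
    have hdum : ∀ i : Fin K, ∃ w ∈ D, (w : ℕ) = K * S + m + i ∨ ((w : ℕ) < K * S ∧ (w : ℕ) / S = i) := by
      intro i
      have hlt : K * S + m + i < pwN φ K := by rw [hN]; omega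
      rcases hdom ⟨K * S + m + i, hlt⟩ with h | ⟨u, hu, huadj⟩
      · exact ⟨_, h, Or.inl rfl⟩
      · refine ⟨u, hu, Or.inr ?_⟩
        rcases (hadj _ _).1 huadj with ⟨-, h | h⟩
        · by_cases hu' : (u : ℕ) < K * S
          · rw [pwAdj_dummy hu' i.2] at h
            exact ⟨hu', by simpa using h⟩
          · rw [pwAdj_of_le (Nat.not_lt.1 hu')] at h; exact absurd h Bool.false_ne_true
        · rw [pwAdj_of_le (by change K * S ≤ K * S + m + i; omega)] at h
          exact absurd h Bool.false_ne_true
    choose w hwD hw using hdum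
    let f : Fin K → D := fun i => ⟨w i, hwD i⟩
    have hfinj : Function.Injective f := by
      intro i j hij
      have hw' : (w i : ℕ) = w j := by
        have := congrArg (fun x : D => ((x : Fin (pwN φ K)) : ℕ)) hij
        simpa [f] using this
      rcases hw i with hi | ⟨hi, hi'⟩ <;> rcases hw j with hj | ⟨hj, hj'⟩
      · exact Fin.ext (by omega)
      · omega
      · omega
      · exact Fin.ext (by rw [← hi', ← hj', hw'])
    have hcardK : Fintype.card (Fin K) = Fintype.card D := by
      refine le_antisymm (Fintype.card_le_of_injective f hfinj) ?_
      rw [Fintype.card_coe, Fintype.card_fin]; exact hcard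
    have hfbij : Function.Bijective f :=
      (Fintype.bijective_iff_injective_and_card f).2 ⟨hfinj, hcardK⟩
    -- every vertex of `D` is a witness
    have hmemD : ∀ u ∈ D, ∃ i : Fin K, (u : ℕ) = K * S + m + i ∨ ((u : ℕ) < K * S ∧ (u : ℕ) / S = i) := by
      intro u hu
      obtain ⟨i, hi⟩ := hfbij.2 ⟨u, hu⟩
      refine ⟨i, ?_⟩
      have : (w i : ℕ) = u := by
        have := congrArg (fun x : D => ((x : Fin (pwN φ K)) : ℕ)) hi
        simpa [f] using this
      rw [← this]; exact hw i
    -- uniqueness inside a group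
    have huniq : ∀ u ∈ D, ∀ u' ∈ D, (u : ℕ) < K * S → (u' : ℕ) < K * S → (u : ℕ) / S = (u' : ℕ) / S →
        u = u' := by
      intro u hu u' hu' hlt hlt' hdiv
      obtain ⟨i, hi⟩ := hfbij.2 ⟨u, hu⟩
      obtain ⟨i', hi'⟩ := hfbij.2 ⟨u', hu'⟩
      have ei : (w i : ℕ) = u := by
        have := congrArg (fun x : D => ((x : Fin (pwN φ K)) : ℕ)) hi; simpa [f] using this
      have ei' : (w i' : ℕ) = u' := by
        have := congrArg (fun x : D => ((x : Fin (pwN φ K)) : ℕ)) hi'; simpa [f] using this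
      have h1 : (u : ℕ) / S = i := by
        rcases hw i with h | ⟨-, h⟩
        · omega
        · rwa [ei] at h
      have h2 : (u' : ℕ) / S = i' := by
        rcases hw i' with h | ⟨-, h⟩
        · omega
        · rwa [ei'] at h
      have hii : i = i' := Fin.ext (by rw [← h1, ← h2, hdiv])
      subst hii
      have := hi.symm.trans hi'
      exact congrArg Subtype.val this
    -- every clause is satisfied by a vertex of `D`
    have hcl : ∀ j, j < m → ∃ u ∈ D, (u : ℕ) < K * S ∧ satB φ B ((u : ℕ) / S) ((u : ℕ) % S) j = true := by
      intro j hj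
      have hlt : K * S + j < pwN φ K := by rw [hN]; omega
      rcases hdom ⟨K * S + j, hlt⟩ with h | ⟨u, hu, huadj⟩
      · obtain ⟨i, hi | ⟨hi, -⟩⟩ := hmemD _ h
        · simp at hi; omega
        · simp at hi
      · rcases (hadj _ _).1 huadj with ⟨-, h | h⟩
        · by_cases hu' : (u : ℕ) < K * S
          · rw [pwAdj_clause hu' hj] at h
            exact ⟨u, hu, hu', h⟩
          · rw [pwAdj_of_le (Nat.not_lt.1 hu')] at h; exact absurd h Bool.false_ne_true
        · rw [pwAdj_of_le (by change K * S ≤ K * S + j; omega)] at h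
          exact absurd h Bool.false_ne_true
    -- the glued assignment
    let τ : ℕ → Bool := fun v => decide (∃ u ∈ D, (u : ℕ) < K * S ∧ (u : ℕ) / S = v / B ∧
      ((u : ℕ) % S).testBit (v % B) = true)
    refine ⟨τ, (CNF.eval_eq_true_iff φ τ).2 fun cl hcl' => ?_⟩
    obtain ⟨j, hj, hjcl⟩ := List.getElem_of_mem hcl'
    obtain ⟨u, hu, hult, hsat⟩ := hcl j hj
    obtain ⟨l, hl, hgrp, hbit⟩ := (satB_eq_true_iff hj).1 hsat
    rw [hjcl] at hl
    simp only [Clause.eval, List.any_eq_true]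
    refine ⟨l, hl, ?_⟩
    simp only [Literal.eval, beq_iff_eq]
    cases hpol : l.2 with
    | true =>
      rw [hpol] at hbit
      simp only [τ, decide_eq_true_eq]
      exact ⟨u, hu, hult, hgrp.symm, hbit⟩
    | false =>
      rw [hpol] at hbit
      simp only [τ, decide_eq_false_iff_not, not_exists, not_and]
      intro u' hu' hult' hgrp' hbit'
      have := huniq u hu u' hu' hult hult' (hgrp.symm.trans hgrp'.symm)
      subst this
      rw [hbit] at hbit'
      exact Bool.false_ne_true hbit'
  · -- from a satisfying assignment to a dominating set
    rintro ⟨σ, hσ⟩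
    rw [CNF.eval_eq_true_iff] at hσ
    let μ : ℕ → ℕ := fun i => Nat.ofBits fun t : Fin B => σ (i * B + t)
    have hμS : ∀ i, μ i < S := fun i => Nat.ofBits_lt_two_pow _
    have hμbit : ∀ i t, t < B → (μ i).testBit t = σ (i * B + t) := fun i t ht => by
      simp only [μ, Nat.testBit_ofBits_lt _ _ ht]
    have hvert_lt : ∀ i, i < K → i * S + μ i < pwN φ K := fun i hi => by
      rw [hN]
      have := hμS i
      calc i * S + μ i < i * S + S := by omega
        _ = (i + 1) * S := by ring
        _ ≤ K * S := Nat.mul_le_mul_right _ hi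
        _ ≤ K * S + m + K := by omega
    have hvert_lt' : ∀ i, i < K → i * S + μ i < K * S := fun i hi => by
      have := hμS i
      calc i * S + μ i < i * S + S := by omega
        _ = (i + 1) * S := by ring
        _ ≤ K * S := Nat.mul_le_mul_right _ hi
    let vert : Fin K → Fin (pwN φ K) := fun i => ⟨i * S + μ i, hvert_lt i i.2⟩
    have hdiv : ∀ i : Fin K, ((vert i : Fin _) : ℕ) / S = i := fun i => by
      show ((i : ℕ) * S + μ i) / S = i
      rw [Nat.mul_comm, Nat.mul_add_div hSpos, Nat.div_eq_of_lt (hμS i), Nat.add_zero]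
    have hmod : ∀ i : Fin K, ((vert i : Fin _) : ℕ) % S = μ i := fun i => by
      show ((i : ℕ) * S + μ i) % S = μ i
      rw [Nat.mul_comm, Nat.mul_add_mod, Nat.mod_eq_of_lt (hμS i)]
    have hvlt : ∀ i : Fin K, ((vert i : Fin _) : ℕ) < K * S := fun i => hvert_lt' i i.2
    refine ⟨Finset.univ.image vert, ?_, fun v => ?_⟩
    · calc (Finset.univ.image vert).card ≤ (Finset.univ : Finset (Fin K)).card :=
          Finset.card_image_le
        _ = K := by rw [Finset.card_univ, Fintype.card_fin]
    -- domination, by the position of `v`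
    have hmem : ∀ i : Fin K, vert i ∈ ((Finset.univ.image vert : Finset _) : Set (Fin (pwN φ K))) :=
      fun i => by simp
    -- a vertex adjacent-or-equal to `vert i` is dominated
    have key : ∀ i : Fin K,
        pwAdj φ B K S m (vert i) v = true →
        v ∈ ((Finset.univ.image vert : Finset _) : Set (Fin (pwN φ K))) ∨
          ∃ u ∈ ((Finset.univ.image vert : Finset _) : Set (Fin (pwN φ K))),
            (adjMatrixGraph (pwMatrix φ K)).Adj u v := by
      intro i h
      by_cases heq : vert i = v
      · exact Or.inl (heq ▸ hmem i)
      · exact Or.inr ⟨vert i, hmem i, (hadj _ _).2 ⟨heq, Or.inl h⟩⟩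
    have hv : (v : ℕ) < K * S + m + K := lt_of_lt_of_eq v.2 hN
    by_cases h1 : (v : ℕ) < K * S
    · -- a partial assignment: dominated by the vertex of its group
      have hi : (v : ℕ) / S < K := Nat.div_lt_of_lt_mul (by rw [Nat.mul_comm]; exact h1)
      refine key ⟨_, hi⟩ ?_
      rw [pwAdj_group (hvlt _) h1, hdiv]
      simp
    by_cases h2 : (v : ℕ) < K * S + m
    · -- a clause: dominated by the group of a true literal
      obtain ⟨j, hj, hvj⟩ : ∃ j, j < m ∧ (v : ℕ) = K * S + j := ⟨v - K * S, by omega, by omega⟩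
      have hclm : φ[j] ∈ φ := List.getElem_mem hj
      obtain ⟨lit, hlit, hval⟩ : ∃ lit ∈ φ[j], Literal.eval σ lit = true := by
        have := hσ _ hclm
        simpa [Clause.eval, List.any_eq_true] using this
      have hvar : lit.1 < n := CNF.lt_numVars_of_mem_of_mem hclm hlit
      have hi : lit.1 / B < K := div_blockLen_lt_of_lt_numVars (by omega) hvar
      have hB0 : 0 < B := by
        rcases Nat.eq_zero_or_pos B with h0 | h0
        · exfalso
          have : n ≤ B * K := le_blockLen_mul (by omega)
          rw [h0, Nat.zero_mul] at this
          omega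
        · exact h0
      refine key ⟨_, hi⟩ ?_
      have hvfin : (v : ℕ) = K * S + j := hvj
      rw [hvfin, pwAdj_clause (hvlt _) hj, hdiv, hmod, satB_eq_true_iff hj]
      refine ⟨lit, hlit, rfl, ?_⟩
      rw [hμbit _ _ (Nat.mod_lt _ hB0), Nat.div_add_mod']
      simpa [Literal.eval] using hval
    · -- a dummy: dominated by the vertex of its group
      obtain ⟨i, hi, hvi⟩ : ∃ i, i < K ∧ (v : ℕ) = K * S + m + i :=
        ⟨v - (K * S + m), by omega, by omega⟩
      refine key ⟨i, hi⟩ ?_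
      have hvfin : (v : ℕ) = K * S + m + i := hvi
      rw [hvfin, pwAdj_dummy (hvlt _) hi, hdiv]
      simp

end Correctness

/-! ### The encoding of the instance -/

/-- The size of the instance is its number of vertices `N`. [folklore] -/
@[simp] theorem kDominatingSet_size_pwInstance (φ : CNF ℕ) (K : ℕ) :
    (kDominatingSet K).size (pwInstance φ K) = pwN φ K := rfl

/-- The encoding of the instance is the encoded adjacency matrix. [folklore] -/
theorem kDominatingSet_encode_pwInstance (φ : CNF ℕ) (K : ℕ) :
    (kDominatingSet K).encode (pwInstance φ K) = encodeBoolMatrix (pwMatrix φ K) := rfl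

/-- The encoding has length `N² + 1`. [folklore] -/
theorem length_kDominatingSet_encode_pwInstance (φ : CNF ℕ) (K : ℕ) :
    ((kDominatingSet K).encode (pwInstance φ K)).length = pwN φ K ^ 2 + 1 := by
  rw [kDominatingSet_encode_pwInstance, encodeBoolMatrix_length]

/-- Word `0` of the encoding is `N`. [folklore] -/
theorem kDominatingSet_encode_pwInstance_getElem?_zero (φ : CNF ℕ) (K : ℕ) :
    ((kDominatingSet K).encode (pwInstance φ K))[0]? = some (pwN φ K) := rfl

/-- Word `1 + (a N + c)` of the encoding is the adjacency bit `pwAdj a c`. [folklore] -/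
theorem kDominatingSet_encode_pwInstance_getElem?_entry (φ : CNF ℕ) (K : ℕ) {a c : ℕ}
    (ha : a < pwN φ K) (hc : c < pwN φ K) :
    ((kDominatingSet K).encode (pwInstance φ K))[1 + (a * pwN φ K + c)]? =
      some (pwAdj φ (blockLen φ.numVars K) K (2 ^ blockLen φ.numVars K) φ.length a c).toNat := by
  rw [kDominatingSet_encode_pwInstance, encodeBoolMatrix_getElem?_entry _ ⟨a, ha⟩ ⟨c, hc⟩]
  rfl

/-- Every word of the encoding is at most `max N 1`. [folklore] -/
theorem le_of_mem_kDominatingSet_encode_pwInstance (φ : CNF ℕ) (K : ℕ) {v : ℕ}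
    (hv : v ∈ (kDominatingSet K).encode (pwInstance φ K)) : v ≤ max (pwN φ K) 1 := by
  rw [kDominatingSet_encode_pwInstance] at hv
  exact le_of_mem_encodeBoolMatrix _ hv

/-- **The input width of the instance** is `Nat.size (N² + 1)`: the length `N² + 1` of the
encoding dominates every word (`N ≤ N² + 1`, bits `≤ 1`). [folklore] -/
theorem inputWidth_kDominatingSet_encode_pwInstance (φ : CNF ℕ) (K : ℕ) :
    inputWidth ((kDominatingSet K).encode (pwInstance φ K)) = Nat.size (pwN φ K ^ 2 + 1) := by
  unfold inputWidth
  rw [length_kDominatingSet_encode_pwInstance, max_eq_left]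
  refine foldr_max_one_le (by omega) fun v hv =>
    (le_of_mem_kDominatingSet_encode_pwInstance φ K hv).trans ?_
  refine max_le ?_ (by omega)
  nlinarith [Nat.zero_le (pwN φ K)]

/-- The width of the instance. [folklore] -/
theorem kDominatingSet_width_pwInstance (φ : CNF ℕ) (K : ℕ) :
    (kDominatingSet K).width (pwInstance φ K) = Nat.size (pwN φ K ^ 2 + 1) :=
  inputWidth_kDominatingSet_encode_pwInstance φ K

open scoped Classical in
/-- **The accepted output on the instance** (`K ≥ 1`): `[1]` if `φ` is satisfiable, `[0]`
otherwise. [folklore] -/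
theorem kDominatingSet_good_pwInstance {φ : CNF ℕ} {K : ℕ} (hK : 1 ≤ K) :
    (kDominatingSet K).Good (pwInstance φ K) = {[if φ.Satisfiable then 1 else 0]} := by
  change (if HasDominatingSetOfCard (adjMatrixGraph (pwMatrix φ K)) K then {[1]}
    else {[0]} : Set (List ℕ)) = _
  rw [hasDominatingSetOfCard_pwMatrix_iff hK]
  by_cases h : φ.Satisfiable <;> simp [h]

/-- `K ≤ N`. [folklore] -/
theorem le_pwN (φ : CNF ℕ) (K : ℕ) : K ≤ pwN φ K := Nat.le_add_left _ _

/-- `m ≤ N`. [folklore] -/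
theorem length_le_pwN (φ : CNF ℕ) (K : ℕ) : φ.length ≤ pwN φ K := by unfold pwN; omega

end Literature.Computability.FineGrained
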